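import Summits.QuantumFields.YangMills.Theorems.BalabanUVNodesN19RateEdgeTubeC1
import Summits.QuantumFields.YangMills.Theorems.BalabanUVNodesN19LiaisonC1Holder
import Summits.QuantumFields.YangMills.Theorems.BalabanUVNodesSpineRatesHolder

/-!
# BalabanUVNodes ∕ N19 — THE BY-NAME N19′ RATE EDGE IN THE R-β (HÖLDER) CURRENCY: the «v9» edge reading
# `N19RateEdgeTubeC1.rateEdge_of_linkReading_byName_pairDiscC1` with the K4 conclusion of record `RatesHolderAt D R β`
# (N16's slot = the β-root `N16HolderAt R.ne3 β`) in place of `RatesAt D R`, N16 consumed through dag-n16-c's Hölder liaison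
# `N19LiaisonC1Holder.ne3LiaisonC1_of_covRootHolder` (rate base `θ^{3β−2}`)

Cell `pub-ymgap`, HUMAN RULING D-0062 (Track A) + D-0149 (work-bound push, director-ym №197), R134 ACCELERATION seat `pub-ymgap-dag-n19-d`
(N19 NE7, strategy s2 = by-name knit at the record), generation g22; bus INTENT-E (I.24019).  Route
`Summits/QuantumFields/YangMills/Theses/BalabanUVNodes.lean` rev 25, cluster item K3⁷ «SpineGivenEndpointR13SepCoPH» (stmt-QuantumFields-20544); filed
`--kind proof --supports` that item `--as helper` (it proves no registered stub).  COUNT-NEUTRAL.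

PROVENANCE.  -- adapted from `Summits/QuantumFields/YangMills/Theorems/BalabanUVNodesN19RateEdgeTubeC1.lean` (dag-n19-c g4, the «v9»; itself the lift
of the lens seat's `YMLens.DecompNE7v3.LC2` sketch over dag-n19-a's `N19RateEdgeByName.rateEdge_of_linkReading_byName`): statement and proof are v9's
TOKEN FOR TOKEN with exactly FOUR changes — (0) the two record predicates `SRec`∕`RRec` (PARAMETERS in v9) are merged into ONE pair predicate `PRec` over
`(F, D, g₀, os, S, R)` (v9's shape = the product `SRec ∧ RRec`; the merge lets a consumer pin spine AND rate carriers at the SAME Stage-13 tuple); (1) the conclusion reads `RatesHolderAt D R β` (dag-n16-e∕n16-c `SpineRatesHolder`, p573254: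
`N14At R.ne1 ∧ N15At R.ne2 ∧ N16HolderAt R.ne3 β ∧ N17At D R.u3 ∧ N18At R.u3 ∧ N22At R.u3`; at `β = 1` it IS `RatesAt D R`,
`SpineRatesHolder.ratesHolderAt_one_iff`) instead of `RatesAt D R`, and a top-level exponent bound `hβ1 : β ≤ 1` is added; (2) inside clause (v′-16) of
the link reading the target-rate floor `θ ≤ θ₃` becomes dag-n16-c's `θ ^ (3β − 2) ≤ θ₃` (the per-level base of the β-root's (Gᶜ)∕(C)∕(Q) rates,
`N16HolderWindow.rate_holder_eq_margin_mul`); (3) the proof reads N16's slot `hrates.2.2.1 : N16HolderAt R.ne3 β` = `CovRootHolder 4 (sfClass …) … β R.ne3.dom`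
(`N16HolderDefs.n16HolderAt_iff`, `Iff.rfl`) with `R.ne3.g = gradConst 4 c′` and calls `N19LiaisonC1Holder.ne3LiaisonC1_of_covRootHolder` (dag-n16-c g3
file 18; its header: «N19's lineage did not TAKE the β version either») at the place of `N19InEdgesC1.ne3LiaisonC1_of_covRoot`.  The (2.43) window
exponent bound by the ∃ of clause (iii) is renamed `βw` (was `β`) to keep it apart from the Hölder exponent; α-renaming only.  Everything else —
(i) the ledger predicate, (ii-m), (iii), (iv), (ii-v-A∕B), (ii-d), the rest of (v′-16), (v′-17), the box, (T) in the tube currency, the windows, and the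
knit (`core_summable_of_ledgerAtSync_multByName` over `ledgerAtSync_withLoc`; N14 · N17 · N18 · N22 from the SAME conjunct positions) — is BYTE-IDENTICAL
to v9.  v9 p475545, v8 p461774, dag-n19-a's p421499 and dag-n16-c's file 18 are CITED BY NAME and not edited.

WHY (numbers, not adjectives).  The K3⁷-side composer of record — dag-n27-c's leaf D `…N27SpineGivenEndpointR13SepCoPHKeyedCore` over XXIVc
`…N27AtRecord13CoPHKeyedCore.keyedGuarded₁₃CoPH_of_keyedFacesRatesHolder` — keys the six rate faces on `RatesHolderAt (datumOfRecord₁₃CoPH F N θ hP)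
(rr F θ hP g₀ os) β` with `2∕3 < β < 1` ([Balaban1985Variational] (1.36) p. 82 exponent of N16's N05-socket, dag-n16-c `LOCATED-N16-HOLDER-PIN.md`) and
displays N19's slot as `h19 : … RatesHolderAt … β → ∃ δ, NE7.Core (cr …) … δ ∧ Summable δ`.  Every landed N19 edge (dag-n19-a p421499, dag-n19-c v8∕v9,
this lane's ₁₁∕₁₂∕₁₃ home faces `rateEdge_…_iff`) reads `RatesAt D R` — `rg RatesHolderAt` over the N19 Theorems files = 0 hits (2026-08-27 22:40Z) —
and dag-n16-c's Hölder liaison had no N19 consumer.  This file is the missing currency port; its sibling `…N19RateEdgeHolderAtRecord13CoPH` (INTENT-F)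
reads it at the Stage-13 `CoPH` regime homes and hands leaf D its `h19` MODULO the displayed link reading `hlink` (NODE O's `LedgerDataSync` world).

HONEST FRAMING.  Count-neutral kernel bookkeeping; NE7 ∕ NE3 ∕ N16 ∕ N07 NOT PRINTED as two-run statements and NOT proved (`h16`'s `CovRootHolder`,
`LeafH3sup`, the selection, the readings, `hdomC1`, every (T) input are HYPOTHESES inside `hlink`); `PRec` is a PARAMETER (no carrier of record
is instantiated here); nothing of Bałaban's is asserted; N19 NOT discharged; Track A count unmoved (5∕27 · A 5∕28).  One finite four-torus at fixed ε,
rung (B)+1 — NOT infinite volume, NOT OS on ℝ⁴, NOT a mass gap, NOT Clay.  THEOREMS ONLY; 0 `def`; 0 `sorry`; standard axioms.  Supersedes nothing.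
-/

set_option autoImplicit false

noncomputable section

open Finset MeasureTheory
open scoped BigOperators Matrix Matrix.Norms.L2Operator

namespace Summit.QuantumFields.YangMills.BalabanUVNodes.N19RateEdgeHolder

open Literature.MathematicalPhysics.QuantumFieldTheory.Balaban1983to89
open T4OutputRate T4RecentScale T4GoodClassBudget T4CauchySum T4TowerRateComposition T4TowerRateDischarge
open T4EtaRateMin (Readings NE3Shape)
open T4RateLiaison (GaugeDominated)
open T4CouplingMatching (EventualLowerH)
open FlowStep (RGEqH)
open TreeLengthTorus (TFaceConnected torusTreeLen)
open B12TreeDecay (kappa₀)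
open Summit.QuantumFields.BalabanUV.T4Continuum
open AveragingDeficitDualResidual (dualC1 dualC2)
open AveragingDeficitDerivWallProof (wallConst)
open AveragingDeficitPeriodicCounting (IsPeriodicDir)
open MinimalActionSandwich (IsMinimiser minAct)
open MinimalActionRate (sfClass)
open MinimalActionRefine (RegularSup gradConst)
open NE3EnergyShapes (IsUnitarySite IsPeriodicSite)
open NE3.LeafIndexSockets (LeafH3sup)
open Summit.QuantumFields.BalabanUV.T4Continuum.Spine
open Summit.QuantumFields.BalabanUV.T4Continuum.NE1p.DressedRoot (DressedTower DressedStabilityStrict)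
open Summit.QuantumFields.YangMills.BalabanUVNodes.N19LedgerLinkSync (LedgerDataSync LedgerAtSync core_summable_of_ledgerAtSync)
open Summit.QuantumFields.YangMills.BalabanUVNodes.N19MultiplicityByName (core_summable_of_ledgerAtSync_multByName)
open Summit.QuantumFields.YangMills.BalabanUVNodes.N19RateEdge (ne5_of_n18At dressedStabilityStrict_of_n14At)
open Summit.QuantumFields.YangMills.BalabanUVNodes.N19InEdgesAtRecord (ledgerAtSync_withLoc ne3Liaison_of_covRoot injectedRate_of_n17At_readOutAt)
open Summit.QuantumFields.YangMills.BalabanUVNodes.N19LipBracketTube (lipBracket_of_pairDisc lipBracket_at_rateCarriers_of_pairDisc)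
open YMDAG.UVSplit (SpineCarriers SpineRecordPred InputsPred U3Carriers RateCarriers RateRecordPred N14At N18At N22At ReadOutAt)
open Summit.QuantumFields.YangMills.BalabanUVNodes.N16HolderDefs (CovRootHolder N16HolderAt)
open Summit.QuantumFields.YangMills.BalabanUVNodes.SpineRatesHolder (RatesHolderAt)
open Summit.QuantumFields.YangMills.BalabanUVNodes.N19LiaisonC1Holder (ne3LiaisonC1_of_covRootHolder)


/-! ## §1 The by-name link reading at the two carrier records in the R-β currency (v9 ∘ dag-n16-c's Hölder liaison) -/

section Edge

variable {N : ℕ} [NeZero N]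

/-- **THE N19′ RATE EDGE AT THE TWO CARRIER RECORDS IN THE R-β CURRENCY — IN-EDGES BY NAME FROM `RatesHolderAt D R β`, (T) IN THE TUBE
CURRENCY, N16's β-ROOT THROUGH THE HÖLDER LIAISON** [bookkeeping].  IDENTICAL to dag-n19-c's v9 `N19RateEdgeTubeC1.rateEdge_of_linkReading_byName_pairDiscC1`
EXCEPT: the rates hypothesis is `RatesHolderAt D R β` (third conjunct `N16HolderAt R.ne3 β`, dag-n16-c), `hβ1 : β ≤ 1` is a top-level bound, the two record predicates
`SRec`, `RRec` are merged into ONE pair predicate `PRec F D g₀ os S R` (v9's shape is `PRec := fun F D g₀ os S R => SRec F D g₀ os S ∧ RRec F D g₀ os R`; the sibling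
`…N19RateEdgeHolderAtRecord13CoPH` needs the SAME-TUPLE pair predicate of the Stage-13 `CoPH` regime homes, which is not a product), and inside
clause (v′-16) the target-rate floor is `θ ^ (3β − 2) ≤ θ₃` (was `θ ≤ θ₃`; for `2∕3 < β ≤ 1` and `θ < 1` this is a genuine floor below `1`).  Proof: v9's
knit verbatim with `N19LiaisonC1Holder.ne3LiaisonC1_of_covRootHolder` in place of `N19InEdgesC1.ne3LiaisonC1_of_covRoot`; N14 · N17 · N18 · N22 are read
from the same conjunct positions of `RatesHolderAt` as of `RatesAt`.  NOT NE7; N19 NOT discharged; `hlink` is NODE O's world, DISPLAYED. [folklore] -/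
theorem rateEdge_of_linkReading_byName_pairDiscC1Holder
    (PRec : (F : T4Continuum.T4Family) → YMDAG.UVSplit.Datum F N → (ℕ → ℝ) → List (T4Continuum.ULoop F) → SpineCarriers → RateCarriers N → Prop)
    {β : ℝ} (hβ1 : β ≤ 1)
    (hlink : ∀ (F : T4Continuum.T4Family) (D : YMDAG.UVSplit.Datum F N) (g₀ : ℕ → ℝ) (os : List (T4Continuum.ULoop F))
      (S : SpineCarriers) (R : RateCarriers N), PRec F D g₀ os S R → letI := S.dec
      ∃ (_ : DecidableEq R.u3.C.Dom) (F' : Type) (ι' X' : Type) (_ : MeasurableSpace ι')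
        (L : LedgerDataSync R.u3.C F' ι' S.ι) (Rd : Readings ι' X') (bsel : (ℕ → ℝ) → ℝ) (EB : Functional R.u3.C R.u3.C.BgB)
        (θc θ₃ : ℝ) (g : ℕ → ℕ → ℝ)
        (uA : ℕ → ι' → R.u3.C.BgA) (uB : ℕ → ι' → R.u3.C.BgB)
        (Pf : ℕ → Params) (d₀ L₀ Koff : ℕ) (cells : (K j : ℕ) → R.u3.C.Dom → Finset (Site (Pf K) j))
        (H033 : Flow → ℕ → Prop) (I : Type) (fam : I → B14.Sect2Data) (Lb βw : ℝ) (κ₁ : ℕ) (Gv Cl : ℝ) (K₁ : ℕ)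
        (Λ₀ N₀ : ℝ) (dressed : R.u3.C.Dom → Prop) (_ : DecidablePred dressed)
        -- N16-side letters: regime, selection, reading map, NE7 route-#1 side letters, offset
        (c' t ε₁ θ γ₃ l₁ : ℝ)
        (sel : ℕ → (B7Prop1Explicit.Site 4 → Fin 4 → (Matrix (Fin N) (Fin N) ℂ)ˣ) → (B7Prop1Explicit.Site 4 → Fin 4 → (Matrix (Fin N) (Fin N) ℂ)ˣ))
        (rd : ι' → (B7Prop1Explicit.Site 4 → Fin 4 → (Matrix (Fin N) (Fin N) ℂ)ˣ)) (k₀ : ℕ)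
        -- N17-side letters: infrared pin, β-window
        (gIR bβ : ℝ) (k₀β : ℕ)
        -- TUBE letters of the bracket (T): the (1.18) constant, the layer factor and (2.28)'s `C₁, q₁`, the flow's `β′`
        (E₀T κ₁T C₁T β'T : ℝ) (q₁ : ℕ),
        -- the run-B functional is the first-coupling family read through the selector
        EB = (fun s => R.u3.EB (bsel s) s) ∧
        -- (i) the ledger predicate for whatever size data and census constants meet their clauses
        (∀ (Sz : ℕ → ℝ → S.ι → ℕ → ℝ) (E₀ : ℝ) (m : ℕ) (a : ℝ) (Cw Λg : ℝ),
          (∀ K t, |t| ≤ S.l₀ → ∀ τ ∈ S.T K \ S.Bad K t, ∀ v ∈ Rd.dom, ∀ j ≤ K,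
            |∑ X ∈ L.fac K t τ with R.u3.C.scale X = j,
                (Real.log (Real.exp (EB (fun i => g (K + 1) (i + 1)) (uB K v) X
                    - EB (fun i => g (K + 1) (i + 1)) L.oneB X))
                  - Real.log (Real.exp (R.u3.EA (g K) (uA K v) X - R.u3.EA (g K) L.oneA X)))| ≤ Sz K t τ j) →
          0 ≤ E₀ → 0 < a → a < 1 →
          (∀ K t, |t| ≤ S.l₀ → ∀ τ ∈ S.T K \ S.Bad K t, ∀ j ≤ K,
            Sz K t τ j ≤ S.vol * (E₀ * ((K : ℝ) + 1) ^ m * a ^ (K - j))) →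
          (∀ K, Multiplicity (L.All K) R.u3.C.scale (fun X => Real.exp (-(R.u3.κ * R.u3.C.d X))) Cw S.vol Λg K) →
          (∀ K t, |t| ≤ S.l₀ → ∀ τ ∈ S.T K \ S.Bad K t,
            WindowMultiplicity (L.facO K t τ) L.scO L.wO Cw S.vol Λg (jlogOf L.Cl K) K) →
          1 ≤ Λg → L.θ' ≤ Λg →
          LedgerAtSync { L with S := Sz, E₀ := E₀, m := m, a := a, Cw := Cw, Λg := Λg } S.l₀ S.vol S.T S.Bad
            (fun K t τ => S.A K t τ - S.shA K t τ) (fun K t τ => S.B K t τ - S.shB K t τ) Rd R.u3.EA EB R.u3.κ g uA uB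
            R.u3.ω θc R.u3.θ θ₃) ∧
        0 ≤ S.vol ∧
        (∀ K t, |t| ≤ S.l₀ → ∀ τ ∈ S.T K \ S.Bad K t,
          WindowMultiplicity (L.facO K t τ) L.scO L.wO L.Cw S.vol L.Λg (jlogOf L.Cl K) K) ∧
        0 ≤ L.Cw ∧ 1 ≤ L.Λg ∧ L.θ' ≤ L.Λg ∧
        -- (ii-m) the reference ledger's lattice identification
        (∀ K, (Pf K).d = d₀) ∧ (∀ K, (Pf K).L = L₀) ∧ (∀ K, (Pf K).K = Koff + K) ∧
        (∀ K, (Fintype.card (Site (Pf K) (Pf K).K) : ℝ) = S.vol) ∧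
        kappa₀ (4 * 2 ^ d₀) (2 * d₀) ≤ R.u3.κ ∧
        (∀ K, ∀ X ∈ L.All K,
          (cells K (R.u3.C.scale X + Koff) X).Nonempty ∧ TFaceConnected (cells K (R.u3.C.scale X + Koff) X)) ∧
        (∀ K j, Set.InjOn (cells K j) ↑((L.All K).filter fun X => R.u3.C.scale X + Koff = j)) ∧
        (∀ K, ∀ X ∈ L.All K, torusTreeLen (cells K (R.u3.C.scale X + Koff) X) ≤ R.u3.C.d X) ∧
        -- (iii) [III] Theorem 2 (2.43) AS PRINTED with window letters
        B14.Thm2Printed H033 fam Lb βw κ₁ ∧ βw < 1 ∧ 0 < βw ∧ 1 < Lb ∧ 1 ≤ Gv ∧ 0 ≤ Cl ∧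
        -- (iv) the positional-count half of N14's pinned pair at a rate `≤ R.ne1.Λ`
        (∀ p K, (R.ne1.𝒯.B p K).PositionalCount fun j k => N₀ * Λ₀ ^ (k - j)) ∧ 0 ≤ N₀ ∧ 0 ≤ Λ₀ ∧ Λ₀ ≤ R.ne1.Λ ∧
        -- (ii-v-A) run A's vacuum slices ↔ printed E-terms
        (∀ K t, |t| ≤ S.l₀ → ∀ τ ∈ S.T K \ S.Bad K t, ∀ v ∈ Rd.dom, ∀ j ≤ K, ∃ (i : I) (w : (fam i).Ω) (j' : ℕ),
          (fam i).flow.SatisfiesRG (fam i).K ∧ H033 (fam i).flow (fam i).K ∧ 1 ≤ j' ∧ j' ≤ (fam i).K ∧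
          (fam i).K - j' = K - j ∧ (fam i).K ≤ K + K₁ ∧
          (∀ n, 0 ≤ (fam i).gammaVol n w) ∧ (fam i).gammaVol (fam i).K w ≤ S.vol ∧
          (∀ n, n < (fam i).K → n < jlogOf Cl (fam i).K → (fam i).gammaVol n w = 0) ∧
          (∀ n, n < (fam i).K → jlogOf Cl (fam i).K ≤ n → (fam i).gammaVol n w ≤ S.vol * Gv ^ ((fam i).K - n)) ∧
          |∑ X ∈ (L.fac K t τ).filter (fun X => ¬ dressed X) with R.u3.C.scale X = j,
              (R.u3.EA (g K) (uA K v) X - R.u3.EA (g K) L.oneA X)| ≤ |(fam i).eTerm j' (fam i).K w|) ∧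
        -- (ii-v-B) run B's vacuum slices ↔ printed E-terms
        (∀ K t, |t| ≤ S.l₀ → ∀ τ ∈ S.T K \ S.Bad K t, ∀ v ∈ Rd.dom, ∀ j ≤ K, ∃ (i : I) (w : (fam i).Ω) (j' : ℕ),
          (fam i).flow.SatisfiesRG (fam i).K ∧ H033 (fam i).flow (fam i).K ∧ 1 ≤ j' ∧ j' ≤ (fam i).K ∧
          (fam i).K - j' = K - j ∧ (fam i).K ≤ K + K₁ ∧
          (∀ n, 0 ≤ (fam i).gammaVol n w) ∧ (fam i).gammaVol (fam i).K w ≤ S.vol ∧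
          (∀ n, n < (fam i).K → n < jlogOf Cl (fam i).K → (fam i).gammaVol n w = 0) ∧
          (∀ n, n < (fam i).K → jlogOf Cl (fam i).K ≤ n → (fam i).gammaVol n w ≤ S.vol * Gv ^ ((fam i).K - n)) ∧
          |∑ X ∈ (L.fac K t τ).filter (fun X => ¬ dressed X) with R.u3.C.scale X = j,
              (EB (fun i => g (K + 1) (i + 1)) (uB K v) X - EB (fun i => g (K + 1) (i + 1)) L.oneB X)|
            ≤ |(fam i).eTerm j' (fam i).K w|) ∧
        -- (ii-d) the dressed sub-ledger ↔ N14's bookings on `R.ne1.𝒯`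
        (∀ K t, |t| ≤ S.l₀ → ∀ τ ∈ S.T K \ S.Bad K t, ∀ v ∈ Rd.dom,
          ∃ (pA : R.ne1.P) (βA : R.u3.C.Dom → (R.ne1.𝒯.B pA K).Birth) (Q : Finset (R.ne1.𝒯.B pA K).Cube) (pB : R.ne1.P)
            (KB : ℕ) (βB : R.u3.C.Dom → (R.ne1.𝒯.B pB KB).Birth),
          (∀ X ∈ (L.fac K t τ).filter (fun X => dressed X), (R.ne1.𝒯.B pA K).birthScale (βA X) = R.u3.C.scale X) ∧
          (∀ j, Set.InjOn βA ↑(((L.fac K t τ).filter (fun X => dressed X)).filter fun X => R.u3.C.scale X = j)) ∧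
          (∀ c ∈ Q, (R.ne1.𝒯.B pA K).cubeScale c = K) ∧ ((Q.card : ℝ) ≤ S.vol) ∧
          (∀ X ∈ (L.fac K t τ).filter (fun X => dressed X), ∃ c ∈ Q, βA X ∈ (R.ne1.𝒯.B pA K).feltAt c) ∧
          (∀ X ∈ (L.fac K t τ).filter (fun X => dressed X), KB - (R.ne1.𝒯.B pB KB).birthScale (βB X) = K - R.u3.C.scale X) ∧
          (∀ X ∈ (L.fac K t τ).filter (fun X => dressed X),
            |R.u3.EA (g K) (uA K v) X - R.u3.EA (g K) L.oneA X| ≤ (R.ne1.𝒯.B pA K).size (βA X) K) ∧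
          (∀ X ∈ (L.fac K t τ).filter (fun X => dressed X),
            |EB (fun i => g (K + 1) (i + 1)) (uB K v) X - EB (fun i => g (K + 1) (i + 1)) L.oneB X|
              ≤ (R.ne1.𝒯.B pB KB).size (βB X) KB)) ∧
        -- (v′-16) N16 BY NAME: THE END's regime letters of `R.ne3`, N07's interface, the selection, NE7 route-#1's side letters, the
        -- reading map, the action-reading identification, the offset, the gauge-domination convention
        R.ne3.g = gradConst 4 c' ∧ 2 ≤ R.ne3.L ∧ 1 ≤ R.ne3.Nper ∧ 0 ≤ R.ne3.b ∧ 0 ≤ c' ∧ R.ne3.b ≤ t ∧ c' ≤ t ∧ 0 ≤ R.ne3.C ∧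
        (2 : ℝ) ^ 91 * (R.ne3.L : ℝ) ^ 17 * t ≤ 1 ∧ (2 : ℝ) ^ 76 * (R.ne3.L : ℝ) ^ 12 * t ≤ R.ne3.ε ∧
        16 * B7Prop2Explicit.C0 4 * R.ne3.ε ≤ 3 ∧ 1024 * (4 + 1) * (4 + 4) * (R.ne3.L : ℝ) ^ 2 * R.ne3.ε ≤ 1 ∧
        ε₁ ≤ 1 / 4 ∧ ε₁ ≤ R.ne3.b ∧ 4 * ε₁ ≤ c' ∧ R.ne3.dom ⊆ sfClass 4 R.ne3.L R.ne3.Nper ε₁ 0 ∧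
        LeafH3sup 4 R.ne3.L R.ne3.Nper R.ne3.ε R.ne3.b c' R.ne3.dom ∧
        (∀ V ∈ R.ne3.dom, ∀ k : ℕ, IsMinimiser 4 (sfClass 4 R.ne3.L R.ne3.Nper R.ne3.ε) R.ne3.L R.ne3.Nper k V (sel k V)) ∧
        (∀ V ∈ R.ne3.dom, ∀ k : ℕ, RegularSup 4 R.ne3.L R.ne3.Nper R.ne3.b c' k (sel k V)) ∧
        0 < θ ∧ θ ^ 6 = ((R.ne3.L : ℝ))⁻¹ ∧ 0 < R.ne3.Λ₂' ∧ 0 < γ₃ ∧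
        R.ne3.C * (wallConst 4 R.ne3.L * (R.ne3.Nper : ℝ) ^ 2 *
          (Real.sqrt (gradConst 4 c') * dualC2 4 R.ne3.L + 2 * R.ne3.b ^ 2 * dualC1 4 R.ne3.L)) ≤ γ₃ ^ 3 ∧
        0 < l₁ ∧ R.ne3.Λ₁ ≤ l₁ ^ 3 ∧ γ₃ * θ ^ 2 ≤ l₁ * R.ne3.Nper ∧ θ ^ ((3 : ℝ) * β - 2) ≤ θ₃ ∧ θ₃ < 1 ∧
        (∀ v ∈ Rd.dom, rd v ∈ R.ne3.dom) ∧
        (∀ k, ∀ v ∈ Rd.dom, Rd.act k v = minAct 4 (sfClass 4 R.ne3.L R.ne3.Nper R.ne3.ε) R.ne3.L R.ne3.Nper k (rd v)) ∧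
        (R.ne3.Nper : ℝ) ^ 4 ≤ Rd.vol ∧ 1 ≤ k₀ ∧
        (∀ K : ℕ, ∀ v ∈ Rd.dom, ∀ (u : B7Prop1Explicit.Site 4 → (Matrix (Fin N) (Fin N) ℂ)ˣ)
          (Z : B7Prop1Explicit.Site 4 → Fin 4 → Matrix (Fin N) (Fin N) ℂ) (M : ℝ),
          IsUnitarySite u → IsPeriodicSite u ((R.ne3.Nper * R.ne3.L ^ (k₀ + K) : ℕ) : ℤ) → T4AveragingDeficitWall.IsSkewDir Z →
          IsPeriodicDir Z ((R.ne3.Nper * R.ne3.L ^ (k₀ + K) : ℕ) : ℤ) →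
          B7Prop1Explicit.gaugeAct u (sel (k₀ + K) (rd v)) =
            T4AveragingDeficitWall.vary (B7Prop2Explicit.rescale R.ne3.L (B7Prop1Explicit.bavg R.ne3.L (sel (k₀ + K + 1) (rd v)))) Z 1 →
          (∀ (x : B7Prop1Explicit.Site 4) (κ : Fin 4), (R.ne3.L : ℝ) ^ (k₀ + K) * ‖Z x κ‖ ≤ M) →
          (∀ (x : B7Prop1Explicit.Site 4) (μ κ : Fin 4), ((R.ne3.L : ℝ) ^ (k₀ + K)) ^ 2 *
              ‖T4AveragingDeficitWall.Ad (B7Prop2Explicit.rescale R.ne3.L (B7Prop1Explicit.bavg R.ne3.L (sel (k₀ + K + 1) (rd v)))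
                  (x + B7Prop1Explicit.e κ) μ) (Z (x + B7Prop1Explicit.e μ) κ) - Z x κ‖ ≤ M) →
          R.u3.C.gauge (uA K v) (R.u3.C.transport (uB K v)) ≤ M) ∧
        -- letter signs
        0 ≤ R.u3.θ ∧ 0 ≤ R.u3.C₅ ∧ 0 ≤ R.u3.ω ∧
        -- (v′-17) N17 BY NAME: the (0.20)-run identification, the infrared pin, (D4), the β-window, the smallness window, rates
        (∀ K, RGEqH K D.βfun (g K)) ∧ (∀ K, g K K = gIR) ∧ ReadOutAt D R.u3 ∧ 0 < bβ ∧
        EventualLowerH bβ R.u3.γ k₀β D.βfun ∧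
        R.u3.cr * R.u3.C₉ * R.u3.ω * (((k₀β : ℝ) + 1) * R.u3.γ ^ 3 + 2 * R.u3.γ / bβ) ≤ (1 - R.u3.ρ) / 2 ∧
        0 < R.u3.ρ ∧ R.u3.ρ < 1 ∧ 0 < R.u3.γ ∧ R.u3.ρ ≤ θc ∧
        -- the box
        (∀ K i, i ≤ K → 0 < g K i ∧ g K i ≤ R.u3.γ) ∧
        -- the bracket (T) IN THE TUBE CURRENCY (`N19LipBracketTube.lipBracket_at_rateCarriers_of_pairDisc`'s inputs): the (1.18) real
        -- bound; the pair-disc shape at the printed tube radius κ₁·α(C₁, q₁, s_j) ((2.27)(ii)(iv) through the (1.13)∕(2.39) tube — SHAPE,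
        -- NODE O); signs; the window's smallness; the UPPER running of the tables ((2.6) ∕ (0.31) upper half, β-side conditional, DISPLAYED)
        DecayBound R.u3.EA R.u3.W E₀T R.u3.κ ∧
        (∀ s ∈ R.u3.W, ∀ (X : R.u3.C.Dom) (U U' : R.u3.C.BgA),
          R.u3.C.gauge U U' < κ₁T * B14.alphaJ C₁T q₁ (s (R.u3.C.scale X)) →
          ∃ f : ℂ → ℂ, DifferentiableOn ℂ f (Metric.ball (0 : ℂ) (κ₁T * B14.alphaJ C₁T q₁ (s (R.u3.C.scale X)))) ∧
            f 0 = (R.u3.EA s U X : ℂ) ∧ f (R.u3.C.gauge U U' : ℂ) = (R.u3.EA s U' X : ℂ) ∧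
            ∀ z ∈ Metric.ball (0 : ℂ) (κ₁T * B14.alphaJ C₁T q₁ (s (R.u3.C.scale X))),
              ‖f z‖ ≤ E₀T * Real.exp (-(R.u3.κ * R.u3.C.d X))) ∧
        0 ≤ E₀T ∧ 0 < κ₁T ∧ 0 < C₁T ∧ (∀ s ∈ R.u3.W, ∀ j, 0 < s j ∧ s j ^ 2 ≤ Real.exp (-1)) ∧
        (∀ K j, j ≤ K → 1 / g K j ^ 2 ≤ 1 / gIR ^ 2 + β'T * ((K : ℝ) - j)) ∧ 0 ≤ β'T ∧
        -- window memberships, selector compatibility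
        (∀ K, g K ∈ R.u3.W) ∧ (∀ K, (fun i => g (K + 1) (i + 1)) ∈ R.u3.W) ∧
        (∀ s ∈ R.u3.W, 0 < bsel s ∧ bsel s ≤ R.u3.γ)) :
    ∀ (F : T4Continuum.T4Family) (D : YMDAG.UVSplit.Datum F N) (g₀ : ℕ → ℝ) (os : List (T4Continuum.ULoop F))
      (S : SpineCarriers) (R : RateCarriers N), PRec F D g₀ os S R → RatesHolderAt D R β → letI := S.dec
      ∃ δ : ℕ → ℝ, NE7.Core S.l₀ S.vol S.T S.Bad (fun K t τ => S.A K t τ - S.shA K t τ)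
        (fun K t τ => S.B K t τ - S.shB K t τ) δ ∧ Summable δ := by
  intro F D g₀ os S R hSR hrates
  letI := S.dec
  -- destructure the link reading IN STAGES (one flat 113-component `obtain` is quadratic in the pattern count: ≈ 14 min on the farm)
  obtain ⟨_, F', ι', X', _, L, Rd, bsel, EB, θc, θ₃, g, uA, uB, hrest⟩ := hlink F D g₀ os S R hSR
  obtain ⟨Pf, d₀, L₀, Koff, cells, H033, I, fam, Lb, βw, κ₁, Gv, Cl, K₁, Λ₀, N₀, dressed, _, hrest⟩ := hrest
  obtain ⟨c', t, ε₁, θ, γ₃, l₁, sel, rd, k₀, gIR, bβ, k₀β, E₀T, κ₁T, C₁T, β'T, q₁, hrest⟩ := hrest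
  obtain ⟨hEB, hL, hvol, homult, hCw, hΛg, hθΛ, hPd, hPL, hPK, hcard, hκ₀, hdom, hinj, hlen, hrest⟩ := hrest
  obtain ⟨h11, hβw1, hβw0, hLb, hGv, hCl, hcount, hN₀, hΛ₀, hle, hidA, hidB, hidD, hrest⟩ := hrest
  -- (v′-16)
  obtain ⟨hg3, hL2, hNper, hb, hc', hbt, hct, hC3, hsmall3, hεt, hε1, hε2, hε₁, hε₁b, hε₁c, hdom3, hH3, hsel, hreg, hrest⟩ := hrest
  obtain ⟨hθ0, hθ6, hΛ₂', hγ₃, hγ3, hl₁, hΛl₁, hfit, hθ₃θ, hθ₃1, hrd, hact, hvol3, hk₀, hdomC1, hrest⟩ := hrest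
  -- signs, (v′-17), the box
  obtain ⟨hθ, hC₅, hω, hrun, hpin, hD4, hbβ, hlo, hsmallβ, hρ0, hρ1, hγu, hρθc, hbox, hrest⟩ := hrest
  -- (T) in the tube currency, windows, selector
  obtain ⟨hdecT, hdiscT, hE₀T, hκ₁T, hC₁T, hWsm, hup, hβ'T, hgA, hgB, hbsel⟩ := hrest
  -- the bracket (T) PRODUCED from the tube inputs (`N19LipBracketTube` §4); the infrared coupling is positive by the box and the pin
  have hgIR : 0 < gIR := by
    have h := (hbox 0 0 le_rfl).1
    rwa [hpin 0] at h
  obtain ⟨CU, Pg, hU, hG, hPg⟩ :=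
    lipBracket_at_rateCarriers_of_pairDisc R hdecT hdiscT hE₀T hκ₁T hC₁T hWsm hgA hup hgIR hβ'T
  haveI : Nonempty (Fin N) := ⟨⟨0, Nat.pos_of_ne_zero (NeZero.ne N)⟩⟩
  -- N14 · N18 · N22 from `RatesHolderAt D R β` by name (same conjunct positions as v9's `RatesAt D R`)
  have h14 : DressedStabilityStrict R.ne1.𝒯 R.ne1.Λ := dressedStabilityStrict_of_n14At hrates.1
  have h18 : NE5 R.u3.EA EB R.u3.W R.u3.κ R.u3.θ R.u3.C₅ := by
    rw [hEB]; exact ne5_of_n18At R.u3 hrates.2.2.2.2.1 bsel hbsel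
  have h22 : NE9 R.u3.EA R.u3.W R.u3.κ R.u3.Λ ∧ T4OutputRate.FadingMemory R.u3.C₉ R.u3.ω R.u3.Λ := hrates.2.2.2.2.2
  -- N16 from `RatesHolderAt D R β` by name: the β-root at the bundle (`N16HolderAt R.ne3 β`, `Iff.rfl` to `CovRootHolder … β R.ne3.dom`), read with
  -- `R.ne3.g = gradConst 4 c′`, through dag-n16-c's Hölder liaison (the ONE changed call)
  have h16 : CovRootHolder 4 (sfClass 4 R.ne3.L R.ne3.Nper R.ne3.ε) R.ne3.L R.ne3.Nper R.ne3.b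
      (gradConst 4 c') R.ne3.C R.ne3.Λ₁ R.ne3.Λ₂' β R.ne3.dom := by
    rw [← hg3]; exact hrates.2.2.1
  obtain ⟨C₃, loc, hC₃, h16', hgd⟩ :=
    ne3LiaisonC1_of_covRootHolder (n := Fin N) hL2 hNper hβ1 hb hc' hbt hct hC3 hsmall3 hεt hε1 hε2 hε₁ hε₁b hε₁c hdom3 h16 hH3 sel hsel hreg
      hθ0 hθ6 hΛ₂' hγ₃ hγ3 hl₁ hΛl₁ hfit hθ₃θ hθ₃1 Rd rd hrd hact hvol3 uA uB hk₀ hdomC1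
  -- N17 from `RatesHolderAt D R β` by name: node U2's output on the tables, companions from (D4) · N18 · N22, worsened to the record's rate `θc`
  have hc17 : 0 ≤ R.u3.cr * R.u3.C₅ * R.u3.θ :=
    (Summit.QuantumFields.YangMills.BalabanUVNodes.N19InEdgesAtRecord.histCompanions_of_readOutAt D hD4 hrates.2.2.2.2.1 hrates.2.2.2.2.2).2.2.1
  have hCd : 0 ≤ 2 * (R.u3.cr * R.u3.C₅ * R.u3.θ) / (1 - R.u3.ρ) := div_nonneg (mul_nonneg zero_le_two hc17) (by linarith)
  have hinj17 : InjectedRate (2 * (R.u3.cr * R.u3.C₅ * R.u3.θ) / (1 - R.u3.ρ)) 0 θc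
      (fun K j => T4CouplingMatching.disc (g K) (g (K + 1)) j) :=
    (injectedRate_of_n17At_readOutAt D hrates.2.2.2.1 hD4 hrates.2.2.2.2.1 hrates.2.2.2.2.2 hγu hbβ hρ0 hρ1 hrun hbox hpin hlo
      hsmallβ).mono_rate hCd hρ0.le hρθc
  have hθc : 0 ≤ θc := hρ0.le.trans hρθc
  -- knit v6 on the re-localised readings family (the ledger predicate transfers: `ledgerAtSync_withLoc`)
  exact core_summable_of_ledgerAtSync_multByName (R := (⟨Rd.dom, Rd.act, loc, Rd.vol, Rd.vol_nonneg⟩ : Readings ι' Unit))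
    (fun Sz E₀ m a Cw Λg hSz hE₀ ha0 ha1 hSle hm hom hΛ1 hθΛ' =>
      ledgerAtSync_withLoc (hL Sz E₀ m a Cw Λg hSz hE₀ ha0 ha1 hSle hm hom hΛ1 hθΛ') loc)
    hvol homult hCw hΛg hθΛ Pf hPd hPL hPK hcard hκ₀ cells hdom hinj hlen H033 fam h11 hβw1 hβw0 hLb hGv hCl K₁ ⟨h14, hcount⟩ hN₀ hΛ₀
    hle dressed hidA hidB hidD h16' hC₃ hgd h18 hθ hC₅ h22 hω hinj17 hCd hθc hbox hU hG hPg hgA hgB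

end Edge

end Summit.QuantumFields.YangMills.BalabanUVNodes.N19RateEdgeHolder

end
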